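import Mathlib
import HarnessLib
import Literature.MathematicalPhysics.QuantumFieldTheory.YangMillsOS
import Literature.MathematicalPhysics.QuantumFieldTheory.SpeciesLatticeProducts
import Literature.MathematicalPhysics.QuantumLattice.ContinuumLimitLGT
import Summits.QuantumFields.YangMills.Theorems.MirrorModularBoostsHypercubicLimitCouplingResponseDefs

/-!
# Line `Sketch` (coupling response) of crux `HypercubicLimit` — plane-resolved objects (reshape 3, c2 seat)

Definitions file C for crux `stmt-QuantumFields-16154` (`CoincidenceRotationBootstrap.HypercubicLimit` =
`MirrorModularBoosts.WeakCouplingHypercubicLimit`), line `Sketch`.  Reshape 3 widens the line's input from modulations of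
the CURVATURE coupling to ANISOTROPIC modulations (one real test function per plaquette orientation), because reflection
positivity, E0-hermiticity and the signed-permutation half of the hypercubic clause of the continuum limit need `k`-uniform
bounds for the six PLANE species separately (the lattice time reflection maps the curvature density to the clover density,
which differs from it by plane-dependent one-unit shifts — Disproof §11, line report `Lines/Sketch-c2-cycle1.md` §3b.3).

* `Plane` — the six plaquette orientations `(μ, ν)`, `μ < ν`; `planeSpecies r q` — the single-plaquette species;
* `planeField r sch k q f` — its smeared field at step `k`, renormalised with the CURVATURE's `c_k` and one sixth of its
  counterterm (so that the six plane fields sum to `curvField`, the plaquette expectations being orientation independent);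
  `fieldP r sch k f = Σ_q planeField r sch k q (f q)` — the anisotropically smeared field of a 6-tuple of tests;
* `normP s f = Σ_q |f q|_s`, `DisjP f g` — all components pairwise disjointly supported;
* `responseP`, `ResponseHolomorphyOnePlanes r sch s ε₁ C₀` — C⁺ at order one for anisotropic modulations;
  `ResponseDerivBoundsPlanes`, `UniformMomentBoundsPlanes` — the plane-resolved derivative and moment bounds;
* `PolyRenorm r sch`, `PolyVolume sch` — polynomial bounds on the renormalisation and on the volume growth (witness-side
  conditions every reasonable scheme meets; they neutralise the sup-norm thermal term of the RP-spectral input).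

Nothing is asserted.
-/

noncomputable section

open scoped SchwartzMap
open MeasureTheory ProbabilityTheory Filter Topology
open Literature.MathematicalPhysics.AQFT Literature.MathematicalPhysics.QuantumLattice
open Literature.MathematicalPhysics.QuantumFieldTheory

namespace Summit.QuantumFields.YangMills.Cruxes.HypercubicLimit.CouplingResponse

/-- The six plaquette orientations `(μ, ν)` with `μ < ν`. [folklore] -/
abbrev Plane : Type := {q : Fin 4 × Fin 4 // q.1 < q.2}

section Objects

variable {G : Type} [Group G] [TopologicalSpace G] [IsTopologicalGroup G] [CompactSpace G]
  [MeasurableSpace G] [BorelSpace G]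

/-- **The single-plaquette species** `Re tr r.ρ(U_p)` for the plaquette at the origin in the plane `q` (tree
`plaquetteObservable`; second countability of `G` from the closed embedding `r.ρ`, as for `LatticeRep.curvature`).
The curvature species is the sum of the six. [cite: Wilson1974] -/
def planeSpecies (r : LatticeRep G) (q : Plane) : YMSpecies G :=
  haveI : SecondCountableTopology G :=
    (r.continuous.isClosedEmbedding r.injective).isEmbedding.secondCountableTopology
  plaquetteObservable (d := 4) r.ρ r.continuous q.1.1 q.1.2

/-- The underlying function of `planeSpecies r q` is the plaquette observable. [folklore] -/
@[simp] theorem planeSpecies_F (r : LatticeRep G) (q : Plane) :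
    (planeSpecies r q).F = plaquetteObs r.ρ 0 q.1.1 q.1.2 := rfl

/-- **The smeared plane field** at step `k`: the species `planeSpecies r q` smeared with `f`, renormalised with the
CURVATURE's multiplicative constant `c_k` and one sixth of its counterterm `m_k`. [folklore] -/
def planeField (r : LatticeRep G) (sch : SpeciesScheme (YMSpecies G)) (k : ℕ) (q : Plane)
    (f : 𝓢(EuclideanSpace ℝ (Fin 4), ℝ)) (U : GaugeConfig 4 (sch.side k) G) : ℝ :=
  smearedLatticeField (planeSpecies r q).F (Literature.Probability.LatticeModels.box 4 (sch.L k)) (sch.a k)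
    (sch.c r.curvature k) (sch.m r.curvature k / 6) f (torusLift (sch.side k) U)

/-- **The anisotropically smeared field** of a 6-tuple of real tests: `Σ_q Φ^{q}_k(f_q)`. [folklore] -/
def fieldP (r : LatticeRep G) (sch : SpeciesScheme (YMSpecies G)) (k : ℕ)
    (f : Plane → 𝓢(EuclideanSpace ℝ (Fin 4), ℝ)) (U : GaugeConfig 4 (sch.side k) G) : ℝ :=
  ∑ q, planeField r sch k q (f q) U

/-- The total Schwartz norm of order `s` of a 6-tuple of real tests. [folklore] -/
def normP (s : ℕ) (f : Plane → 𝓢(EuclideanSpace ℝ (Fin 4), ℝ)) : ℝ :=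
  ∑ q, schwartzNorm s (ofRealTest (f q))

/-- Two 6-tuples of tests are **plane-wise disjoint**: every component of the first has support disjoint from
every component of the second. [folklore] -/
def DisjP (f g : Plane → 𝓢(EuclideanSpace ℝ (Fin 4), ℝ)) : Prop :=
  ∀ q q', Disjoint (tsupport (f q)) (tsupport (g q'))

/-- The order-one complex-source RESPONSE of the anisotropic field `Φ^P_k(f)` to the anisotropic coupling modulation
`t · Φ^P_k(g)`: `t ↦ (∫ Φ^P_k(f) e^{t Φ^P_k(g)} dμ_k) / (∫ e^{t Φ^P_k(g)} dμ_k)`. [folklore] -/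
def responseP (r : LatticeRep G) (sch : SpeciesScheme (YMSpecies G)) (k : ℕ)
    (f g : Plane → 𝓢(EuclideanSpace ℝ (Fin 4), ℝ)) (t : ℂ) : ℂ :=
  (∫ U, ((fieldP r sch k f U : ℝ) : ℂ) * Complex.exp (t * ((fieldP r sch k g U : ℝ) : ℂ)) ∂(wilsonAt r sch k)) /
    ∫ U, Complex.exp (t * ((fieldP r sch k g U : ℝ) : ℂ)) ∂(wilsonAt r sch k)

/-- **C⁺ at order one for ANISOTROPIC modulations (the line's input after reshape 3).**  For every observed 6-tuple `f`
and modulating 6-tuple `g`, both of total Schwartz norm `≤ 1` and plane-wise disjointly supported, the order-one response is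
holomorphic on the disc `|t| < ε₁` and bounded there by `C₀`, for every `k`.  The isotropic statement
`ResponseHolomorphyOne` is the special case of constant tuples. [folklore] -/
def ResponseHolomorphyOnePlanes (r : LatticeRep G) (sch : SpeciesScheme (YMSpecies G)) (s : ℕ) (ε₁ C₀ : ℝ) :
    Prop :=
  ∀ (f g : Plane → 𝓢(EuclideanSpace ℝ (Fin 4), ℝ)), normP s f ≤ 1 → normP s g ≤ 1 → DisjP f g →
    ∀ k : ℕ, DifferentiableOn ℂ (responseP r sch k f g) (Metric.ball 0 ε₁) ∧
      ∀ t ∈ Metric.ball (0 : ℂ) ε₁, ‖responseP r sch k f g t‖ ≤ C₀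

/-- **`k`-uniform bounds on all real derivatives at `0` of the anisotropic order-one responses**:
`|dⁿ/dtⁿ|₀ ∫ Φ^P_k(f) d(μ_k.tilted (t Φ^P_k(g)))| ≤ C₀ C₁ⁿ n!` for all normalised plane-wise disjoint pairs of 6-tuples,
all `k`, all `n`. [folklore] -/
def ResponseDerivBoundsPlanes (r : LatticeRep G) (sch : SpeciesScheme (YMSpecies G)) : Prop :=
  ∃ (s : ℕ) (C₀ C₁ : ℝ), ∀ (f g : Plane → 𝓢(EuclideanSpace ℝ (Fin 4), ℝ)), normP s f ≤ 1 → normP s g ≤ 1 →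
    DisjP f g → ∀ k n : ℕ, |iteratedDeriv n (fun t : ℝ => ∫ U, fieldP r sch k f U
      ∂((wilsonAt r sch k).tilted (fun U => t * fieldP r sch k g U))) 0| ≤ C₀ * C₁ ^ n * n.factorial

/-- **`k`-uniform plane-resolved moment bounds with `n!` growth**: for every `n`, every family of normalised, pairwise
plane-wise disjoint 6-tuples `F₁ … F_n`, every `k`, `|∫ ∏ᵢ Φ^P_k(Fᵢ) dμ_k| ≤ C₀ C₁ⁿ n!`.  It contains every plane string
(tuples supported on one component) and, by multilinearity, the curvature strings (constant tuples). [folklore] -/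
def UniformMomentBoundsPlanes (r : LatticeRep G) (sch : SpeciesScheme (YMSpecies G)) : Prop :=
  ∃ (s : ℕ) (C₀ C₁ : ℝ), ∀ (n : ℕ) (F : Fin n → Plane → 𝓢(EuclideanSpace ℝ (Fin 4), ℝ)),
    (∀ i, normP s (F i) ≤ 1) → (∀ i j, i ≠ j → DisjP (F i) (F j)) →
      ∀ k : ℕ, |∫ U, ∏ i, fieldP r sch k (F i) U ∂(wilsonAt r sch k)| ≤ C₀ * C₁ ^ n * n.factorial

/-- **Polynomial renormalisation**: the curvature's multiplicative constant grows at most polynomially in the inverse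
spacing, `|c_k| ≤ (a_k⁻¹)^Q`. [folklore] -/
def PolyRenorm (r : LatticeRep G) (sch : SpeciesScheme (YMSpecies G)) : Prop :=
  ∃ Q : ℕ, ∀ k, |sch.c r.curvature k| ≤ (sch.a k)⁻¹ ^ Q

end Objects

/-- **Polynomial volume growth**: the physical torus half-side dominates a power of the inverse spacing,
`a_k⁻¹ ≤ (a_k L_k)^N` eventually (the scheme type only has `a_k L_k → ∞`). [folklore] -/
def PolyVolume {ι : Type} (sch : SpeciesScheme ι) : Prop :=
  ∃ N : ℕ, 1 ≤ N ∧ ∀ᶠ k in atTop, (sch.a k)⁻¹ ≤ (sch.a k * (sch.L k : ℝ)) ^ N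

section Facts

variable {G : Type} [Group G] [TopologicalSpace G] [IsTopologicalGroup G] [CompactSpace G]
  [MeasurableSpace G] [BorelSpace G]

/-- The anisotropic field is additive in the 6-tuple. [folklore] -/
theorem fieldP_add (r : LatticeRep G) (sch : SpeciesScheme (YMSpecies G)) (k : ℕ)
    (f g : Plane → 𝓢(EuclideanSpace ℝ (Fin 4), ℝ)) (U : GaugeConfig 4 (sch.side k) G) :
    fieldP r sch k (f + g) U = fieldP r sch k f U + fieldP r sch k g U := by
  unfold fieldP planeField smearedLatticeField
  rw [← Finset.sum_add_distrib]
  refine Finset.sum_congr rfl fun q _ => ?_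
  rw [← mul_add, ← Finset.sum_add_distrib]
  congr 1
  refine Finset.sum_congr rfl fun x _ => ?_
  rw [Pi.add_apply, show ((f q + g q) (sch.a k • siteToE x)) = f q (sch.a k • siteToE x) + g q (sch.a k • siteToE x)
    from rfl]
  ring

/-- The anisotropic field is homogeneous in the 6-tuple. [folklore] -/
theorem fieldP_smul (r : LatticeRep G) (sch : SpeciesScheme (YMSpecies G)) (k : ℕ) (c : ℝ)
    (f : Plane → 𝓢(EuclideanSpace ℝ (Fin 4), ℝ)) (U : GaugeConfig 4 (sch.side k) G) :
    fieldP r sch k (c • f) U = c * fieldP r sch k f U := by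
  unfold fieldP planeField smearedLatticeField
  rw [Finset.mul_sum]
  refine Finset.sum_congr rfl fun q _ => ?_
  rw [Finset.mul_sum, Finset.mul_sum, Finset.mul_sum]
  refine Finset.sum_congr rfl fun x _ => ?_
  rw [Pi.smul_apply, show ((c • f q) (sch.a k • siteToE x)) = c * f q (sch.a k • siteToE x) from rfl]
  ring

/-- Each plane field is measurable in the torus configuration. [folklore] -/
theorem measurable_planeField (r : LatticeRep G) (sch : SpeciesScheme (YMSpecies G)) (k : ℕ) (q : Plane)
    (f : 𝓢(EuclideanSpace ℝ (Fin 4), ℝ)) : Measurable (planeField r sch k q f) :=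
  measurable_smearedLatticeField_torusLift (planeSpecies r q) _ _ _ _ f _

/-- Each plane field is bounded. [folklore] -/
theorem exists_bound_planeField (r : LatticeRep G) (sch : SpeciesScheme (YMSpecies G)) (k : ℕ) (q : Plane)
    (f : 𝓢(EuclideanSpace ℝ (Fin 4), ℝ)) : ∃ B, ∀ U, |planeField r sch k q f U| ≤ B := by
  obtain ⟨B, hB⟩ := exists_bound_smearedLatticeField (planeSpecies r q).bounded
    (Literature.Probability.LatticeModels.box 4 (sch.L k)) (sch.a k) (sch.c r.curvature k) (sch.m r.curvature k / 6) f
  exact ⟨B, fun U => hB _⟩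

/-- The anisotropic field is measurable. [folklore] -/
theorem measurable_fieldP (r : LatticeRep G) (sch : SpeciesScheme (YMSpecies G)) (k : ℕ)
    (f : Plane → 𝓢(EuclideanSpace ℝ (Fin 4), ℝ)) : Measurable (fieldP r sch k f) := by
  unfold fieldP
  exact Finset.measurable_sum _ fun q _ => measurable_planeField r sch k q (f q)

/-- The anisotropic field is bounded. [folklore] -/
theorem exists_bound_fieldP (r : LatticeRep G) (sch : SpeciesScheme (YMSpecies G)) (k : ℕ)
    (f : Plane → 𝓢(EuclideanSpace ℝ (Fin 4), ℝ)) : ∃ B, ∀ U, |fieldP r sch k f U| ≤ B := by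
  choose B hB using fun q => exists_bound_planeField r sch k q (f q)
  refine ⟨∑ q, B q, fun U => ?_⟩
  unfold fieldP
  exact (Finset.abs_sum_le_sum_abs _ _).trans (Finset.sum_le_sum fun q _ => hB q U)

end Facts

/-- **Registered sub-goal `fieldP_linear` (line `Sketch`, reshape 3)**: the anisotropically smeared field is linear in the
6-tuple of tests (the one fact the plane-resolved `stub_derivToMomentsPlanes` needs from this file). [folklore] -/
theorem fieldP_linear :
    ∀ (G : Type) [Group G] [TopologicalSpace G] [IsTopologicalGroup G] [CompactSpace G] [MeasurableSpace G] [BorelSpace G] (r : LatticeRep G) (sch : SpeciesScheme (YMSpecies G)) (k : ℕ) (c : ℝ) (f g : Plane → 𝓢(EuclideanSpace ℝ (Fin 4), ℝ)) (U : GaugeConfig 4 (sch.side k) G), fieldP r sch k (c • f + g) U = c * fieldP r sch k f U + fieldP r sch k g U :=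
  fun _ _ _ _ _ _ _ r sch k c f g U => by rw [fieldP_add, fieldP_smul]

end Summit.QuantumFields.YangMills.Cruxes.HypercubicLimit.CouplingResponse

end
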